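import Mathlib
import HarnessLib
import Summits.Langlands.Statement
import Summits.Langlands.Langlands.Theses.WachComponentCensus
import Summits.Langlands.Langlands.Theses.TriangulineChamber

/-!
# Route `WachComponentCensus` — the split-prime slice `LiftB2UnramSplitP` (item `stmt-Langlands-12044`)

Support lemmas for the support item `LiftB2UnramSplitP` of route `Langlands/WachComponentCensus`
(the (B)-direction lifting slice for `n = 2` over a totally real `F` at a prime `p ≥ 7` that SPLITS
COMPLETELY in `F`).  The item is a specialisation of the route's target and of its small-residue-
degree crux, and it implies the split-prime slice of the sibling route `TriangulineChamber`:

* `liftB2UnramSplitP_of_liftB2UnramSmallF` — `LiftB2UnramSmallF → LiftB2UnramSplitP`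
  (`q_v = p ≤ p²`);
* `liftB2UnramSplitP_of_liftB2Unram` — `LiftB2Unram → LiftB2UnramSplitP` (drop the hypothesis);
* `not_dvd_discr_of_forall_not_sq_dvd` — Dedekind's discriminant theorem in the direction
  "every prime of `𝓞 F` above `p` has ramification index `1` ⇒ `p ∤ d_F`" (Mathlib's
  `NumberField.not_dvd_discr_iff_forall_mem` + `not_dvd_differentIdeal_of_isCoprime`), in the
  `HeightOneSpectrum` phrasing of the two route files;
* `liftB2CrysSplitP_of_liftB2UnramSplitP` — the cross-route edge
  `WachComponentCensus.LiftB2UnramSplitP → TriangulineChamber.LiftB2CrysSplitP`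
  (item `stmt-Langlands-8575`): the sibling slice has the same conclusion under the SAME pin and
  (A)₂ clauses, one more hypothesis on `ρ` (residual genericity at `v ∣ p`), and the hypothesis
  "`q_v = p` and `v² ∤ (p)` for every `v ∣ p`" in place of "`p ∤ d_F` and `q_v = p`".

No statement of the route files is altered; the route decls are used BY NAME.
Axioms: `propext`, `Classical.choice`, `Quot.sound`.
-/

set_option linter.dupNamespace false -- project-wide option; `Summit.Langlands.Langlands` is the mandated namespace

namespace Summit.Langlands.Langlands.Theorems

open IsDedekindDomain NumberField

/-- **Dedekind's discriminant theorem, unramified direction, `HeightOneSpectrum` phrasing.**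
If no nonzero prime `v` of `𝓞 F` containing the rational prime `p` has `v² ∣ (p)`, then
`p ∤ d_F`.  Proof: for such `v`, `(p) = v · Q` with `Q` coprime to `v`
(`Ideal.eq_prime_pow_mul_coprime`), so `v ∤ 𝔇_{F/ℚ}` (`not_dvd_differentIdeal_of_isCoprime`),
i.e. `v` is unramified (`not_dvd_differentIdeal_iff`), and `p ∤ d_F` by
`NumberField.not_dvd_discr_iff_forall_mem`. [cite: NeukirchANT1999, III (2.6) and (2.12)] -/
theorem not_dvd_discr_of_forall_not_sq_dvd {F : Type*} [Field F] [NumberField F] {p : ℕ}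
    (hp : p.Prime)
    (h : ∀ v : HeightOneSpectrum (𝓞 F), ((p : ℕ) : 𝓞 F) ∈ v.asIdeal →
      ¬ v.asIdeal ^ 2 ∣ Ideal.span {((p : ℕ) : 𝓞 F)}) :
    ¬ ((p : ℤ) ∣ NumberField.discr F) := by
  classical
  have hpZ : Prime (p : ℤ) := Nat.prime_iff_prime_int.mp hp
  rw [NumberField.not_dvd_discr_iff_forall_mem F (𝓞 F) hpZ]
  intro P hP hpP
  have hpP' : ((p : ℕ) : 𝓞 F) ∈ P := by simpa using hpP
  have hp0 : ((p : ℕ) : 𝓞 F) ≠ 0 := by exact_mod_cast hp.ne_zero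
  have hP0 : P ≠ ⊥ := by
    rintro rfl
    exact hp0 (by simpa using hpP')
  haveI : P.IsMaximal := hP.isMaximal hP0
  set I : Ideal (𝓞 F) := Ideal.span {((p : ℕ) : 𝓞 F)} with hIdef
  have hI0 : I ≠ ⊥ := by
    simpa [hIdef, Ideal.span_singleton_eq_bot] using hp0
  have hIP : I ≤ P := by
    simpa [hIdef, Ideal.span_le] using hpP'
  have hsq : ¬ P ^ 2 ∣ I := h ⟨P, hP, hP0⟩ hpP'
  obtain ⟨Q, hPQ, hIeq⟩ := Ideal.eq_prime_pow_mul_coprime hI0 P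
  set k := Multiset.count P (UniqueFactorizationMonoid.normalizedFactors I) with hkdef
  have hk : k = 1 := by
    have hk1 : k ≠ 0 := by
      intro hk0
      rw [hk0, pow_zero, one_mul] at hIeq
      apply (‹P.IsMaximal›).ne_top
      rw [← hPQ, ← hIeq]
      exact (sup_eq_left.mpr hIP).symm
    have hk2 : k < 2 := by
      by_contra hk2
      replace hk2 : 2 ≤ k := by omega
      apply hsq
      calc P ^ 2 ∣ P ^ k := pow_dvd_pow P hk2
        _ ∣ P ^ k * Q := dvd_mul_right _ _
        _ = I := hIeq.symm
    omega
  rw [hk, pow_one] at hIeq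
  have hmap : Ideal.map (algebraMap ℤ (𝓞 F)) (Ideal.span {(p : ℤ)}) = I := by
    rw [Ideal.map_span, Set.image_singleton, hIdef]
    simp
  haveI hpmax : (Ideal.span {(p : ℤ)}).IsMaximal :=
    ((Ideal.span_singleton_prime hpZ.ne_zero).mpr hpZ).isMaximal
      (by simpa [Ideal.span_singleton_eq_bot] using hpZ.ne_zero)
  haveI : Finite (ℤ ⧸ Ideal.span {(p : ℤ)}) :=
    Ideal.finiteQuotientOfFreeOfNeBot _ (by simpa [Ideal.span_singleton_eq_bot] using hpZ.ne_zero)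
  have hnd : ¬ P ∣ differentIdeal ℤ (𝓞 F) :=
    not_dvd_differentIdeal_of_isCoprime (A := ℤ) (p := Ideal.span {(p : ℤ)}) P Q
      (Ideal.isCoprime_iff_sup_eq.mpr hPQ) (by rw [hmap]; exact hIeq.symm)
  exact not_dvd_differentIdeal_iff.mp hnd

open scoped BigOperators Topology Manifold Classical MeasureTheory ProbabilityTheory Matrix InnerProductSpace ComplexConjugate ContinuousMap
open Filter Set Function TopologicalSpace MeasureTheory

/-- **`LiftB2UnramSmallF → LiftB2UnramSplitP`**: the split-prime slice (`q_v = p` for every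
`v ∣ p`) is the case `q_v = p ≤ p²` of the small-residue-degree crux of route
`WachComponentCensus` (items `stmt-Langlands-12042` ⇒ `stmt-Langlands-12044`). [folklore] -/
theorem liftB2UnramSplitP_of_liftB2UnramSmallF
    (h : Summit.Langlands.Langlands.Theses.WachComponentCensus.LiftB2UnramSmallF) :
    Summit.Langlands.Langlands.Theses.WachComponentCensus.LiftB2UnramSplitP := by
  intro F _ _ _ p _ hp hdisc hsplit
  refine h F p hp hdisc fun v hv => ?_
  rw [hsplit v hv]
  exact Nat.le_self_pow two_ne_zero p

/-- **`LiftB2Unram → LiftB2UnramSplitP`**: the split-prime slice is the route's target with one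
hypothesis dropped (items `stmt-Langlands-12041` ⇒ `stmt-Langlands-12044`; the planner's
`splitP_of_target`). [folklore] -/
theorem liftB2UnramSplitP_of_liftB2Unram
    (h : Summit.Langlands.Langlands.Theses.WachComponentCensus.LiftB2Unram) :
    Summit.Langlands.Langlands.Theses.WachComponentCensus.LiftB2UnramSplitP := by
  intro F _ _ _ p _ hp hdisc _hsplit
  exact h F p hp hdisc

/-- **Cross-route edge `WachComponentCensus.LiftB2UnramSplitP → TriangulineChamber.LiftB2CrysSplitP`**
(items `stmt-Langlands-12044` ⇒ `stmt-Langlands-8575`).  The sibling slice assumes `q_v = p` and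
`v² ∤ (p)` for every `v ∣ p`; by Dedekind (`not_dvd_discr_of_forall_not_sq_dvd`) this gives
`p ∤ d_F`, so the present slice applies, and its conclusion is the sibling's with the residual
genericity hypothesis at `v ∣ p` discarded. [folklore] -/
theorem liftB2CrysSplitP_of_liftB2UnramSplitP
    (h : Summit.Langlands.Langlands.Theses.WachComponentCensus.LiftB2UnramSplitP) :
    Summit.Langlands.Langlands.Theses.TriangulineChamber.LiftB2CrysSplitP := by
  intro F _ _ _ p _ hp hsplit
  have hdisc : ¬ ((p : ℤ) ∣ NumberField.discr F) :=
    not_dvd_discr_of_forall_not_sq_dvd (Fact.out : p.Prime) fun v hv => (hsplit v hv).2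
  obtain ⟨RD, hpin, hrest⟩ := h F p hp hdisc fun v hv => (hsplit v hv).1
  refine ⟨RD, hpin, fun hcpt => ⟨(hrest hcpt).1, ?_⟩⟩
  intro ι ρ hirr hgeom hodd hcrys _hgen hbig hmod
  exact (hrest hcpt).2 ι ρ hirr hgeom hodd hcrys hbig hmod

end Summit.Langlands.Langlands.Theorems
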